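import Summits.BirchSwinnertonDyer.Rank1Residual.Supersingular.KobayashiMainConjectureX7
import Summits.BirchSwinnertonDyer.Rank1Residual.Supersingular.KobayashiSqueezeReal
import Literature.NumberTheory.EllipticCurves.Wuthrich2014.ThreeAdicImageSupersingularProofs
import Literature.NumberTheory.EllipticCurves.PlusMinusPAdicLFunctionProofs
import HarnessLib

/-!
# The Eisenstein-half squeeze at an X7 pair, ROUTE-INDEPENDENT (no `Theses` import), so that the route file
# `Theses/SignedBaseChange.lean` can import it for its deciding theorem `closes` after repair F1(b)
# (K2R″ `SignedLowerDescentFromCommonFrame` concludes `KobayashiLowerDivisibility`; `closes` squeezes with PUB's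
# thm41 / thm12 / `realPeriodRat_eq_unit_mul_plusPeriod`) — prover seat `bsd-wall-sbc-p2`, 2026-08-27

`Theorems/SignedBaseChangeK2RSqueeze.lean` (p512698) proves the same squeeze but imports the route file, so the route
file cannot import it (cycle). This file repeats the 30-line argument against tree lemmas only
(`Rank1Residual/Supersingular/KobayashiSqueezeReal.lean`, `…/KobayashiMainConjectureX7.lean`, `PeriodUnitProofs`):
lower (`g = ϖ L^ε h`) + Kobayashi Thm. 4.1 (`g ∣ L^ε`, integral under `Surj` at a good odd `p`) + `ord_p ϖ = 0`
(`padicValRat_periodRatio_eq_zero_of_five_le`) ⇒ `(g) = (L^ε) = (C(u) L^ε)`, `u = ϖ`.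
§2 (appended): the DESCENT'S OUTPUT INTERFACE — the ϖ-free `f`-normalised product lower divisibility over `ℚ_∞` for
the four `ℚ`-curves of the twist pair — packaged into `KobayashiMainConjecture W p ε` granted thm12/thm41 for all
four curves, MODULARITY (their newforms) and the period unit for `E` (`X7.kobayashiMainConjecture_of_productLowerDivisibility`).
References: [Kobayashi2003] Conjecture (p. 2), Thm. 1.2, Thm. 4.1; [GreenbergVatsal2000] §3 Rem. 3.4; [Pollack2003] Thm. 5.6, Cor. 5.11.
-/

set_option autoImplicit false

noncomputable section

open scoped Classical MatrixGroups ModularForm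

open CongruenceSubgroup WeierstrassCurve Literature.NumberTheory.EllipticCurves
  Literature.NumberTheory.EllipticCurves.ModularForms
  Literature.NumberTheory.EllipticCurves.Rank1Residual
  Literature.NumberTheory.EllipticCurves.Kobayashi2003 ZpExtension
  Summit.BirchSwinnertonDyer.Rank1Residual.Supersingular

namespace Summit.BirchSwinnertonDyer.BirchSwinnertonDyer.Theorems.SignedBaseChangeEisensteinSqueeze

/-- **X7 pair, `p ≥ 5`, `ρ̄` onto: the Eisenstein half of Kobayashi's main conjecture for `(E, p, ε)` implies the whole
conjecture**, granted BY NAME Kobayashi 2003 Thm. 1.2 (`h12`), Thm. 4.1 (`h41`) and the period-unit fact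
`realPeriodRat_eq_unit_mul_plusPeriod` (`h5`) — the three are conjuncts 2, 3, 6 of the route's `PublishedSignedInputs`.
`a_p = 0` and `E[p]` irreducible are automatic on X7 at `p ≥ 5` (`ClassX7.frobeniusTrace_eq_zero_of_five_le`,
`ClassX7.irr`). [cite: Kobayashi2003, Conjecture (p. 2), Thm. 1.2, Thm. 4.1 (p. 8)] [cite: GreenbergVatsal2000, §3 Remark 3.4] -/
theorem X7.kobayashiMainConjecture_of_lowerDivisibility_of_five_le
    (h12 : thm12_signedSelmerDual_finite_torsion) (h41 : thm41_signedCharIdeal_divisibility)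
    (h5 : realPeriodRat_eq_unit_mul_plusPeriod)
    (W : WeierstrassCurve ℚ) [W.IsElliptic] [W.IsGloballyMinimal] (p : ℕ) [Fact p.Prime]
    (hp5 : 5 ≤ p) (hX : ClassX7 W p) (hs : Surj W p)
    (ε : ℤˣ) (hlow : KobayashiLowerDivisibility W p ε) : KobayashiMainConjecture W p ε := by
  have hp : p ≠ 2 := by omega
  have hgood : W.HasGoodReductionAtPrime p := hX.1.1
  have hap : W.frobeniusTrace p = 0 := ClassX7.frobeniusTrace_eq_zero_of_five_le W p hp5 hX
  intro κ γ hκ hγ hγ' _ f hf ϖ hϖ Lplus Lminus hPP D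
  -- Thm. 1.2: `X^ε` finitely generated and torsion
  haveI hfin : Module.Finite (IwasawaAlgebra p) D.X := h12.moduleFinite hp hgood hap hκ hγ D
  have hXt : Module.IsTorsion (IwasawaAlgebra p) D.X := h12.isTorsion hp hgood hap hκ hγ D
  refine ⟨hXt, ?_⟩
  -- the Eisenstein half: `Char(X^ε) = (g)`, `ι g = ϖ · ι(L^ε · h)`
  obtain ⟨g, h, hg, hιg⟩ := hlow κ γ hκ hγ hγ' f hf ϖ hϖ Lplus Lminus hPP D
  set L := kobayashiL ε Lplus Lminus with hL_def
  have hL : IsSignedPAdicLFunction f p ε L := hPP.isSignedPAdicLFunction_kobayashiL ε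
  -- the Kato half (Kobayashi Thm. 4.1, integral under `p`-adic surjectivity): `g ∣ L^ε`
  have hsurj : ∀ m : ℕ, W.HasSurjectiveModNGaloisRep (p ^ m : ℕ) :=
    surjective_pow_of_surj_of_good W p Wuthrich2014.lemma20_surjective_threeAdic_of_semistable_holds hp hgood hs
  have hU : g ∣ L := h41.dvd_of_charIdeal_eq_span hp hgood hap hf hκ hγ hγ' hL D hXt hsurj hg
  -- the period ratio `ϖ` is a `p`-adic unit (named fact `h5`; `E[p]` irreducible on X7)
  have hvϖ : padicValRat p ϖ = 0 :=
    padicValRat_periodRatio_eq_zero_of_five_le h5 W p hp5 hgood (ClassX7.irr W p hp hX) f hf ϖ hϖ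
  have hϖ0 : ϖ ≠ 0 := by
    intro hz
    rw [hz, Rat.cast_zero, zero_mul] at hϖ
    exact (IsNewform0.plusPeriod_pos_holds hf.1 hf.coeffField_eq_bot).ne' hϖ.symm
  obtain ⟨u, hu⟩ := exists_units_coe_eq_ratCast hϖ0 hvϖ
  obtain ⟨hspan', hι⟩ := span_C_units_mul_eq u L
  -- the Eisenstein half read in `Λ`: `g = C(u) · L^ε · h`, hence `L^ε ∣ g`
  have hgL : g = PowerSeries.C (u : ℤ_[p]) * L * h := by
    apply iwasawaToPowerSeries_injective p
    rw [hιg, map_mul (iwasawaToPowerSeries p) (PowerSeries.C (u : ℤ_[p]) * L) h, hι, hu, map_mul, mul_assoc]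
  have hLg : L ∣ g := ⟨PowerSeries.C (u : ℤ_[p]) * h, by rw [hgL]; ring⟩
  -- `(g) = (L^ε) = (C(u) · L^ε)` and `ι(C(u) · L^ε) = ϖ · ι L^ε`
  refine ⟨PowerSeries.C (u : ℤ_[p]) * L, ?_, ?_⟩
  · rw [hg, hspan']
    exact le_antisymm (Ideal.span_singleton_le_span_singleton.mpr hLg)
      (Ideal.span_singleton_le_span_singleton.mpr hU)
  · rw [hι, hu]

/-! ## §2 (appended 2026-08-27). The DESCENT'S OUTPUT INTERFACE and its packaging: a ϖ-free, `f`-normalised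
PRODUCT lower divisibility over `ℚ_∞` for the four `ℚ`-curves `E, E^K, E^{(d)}, E^{(dK)}` (what the two-variable
signed descent of the twist pair delivers after cyclotomic specialisation, BSTW §10.3) implies Kobayashi's main
conjecture for `E`, granted Kobayashi Thm. 4.1 / 1.2 for ALL FOUR curves (hence MODULARITY, to have their newforms)
and the period unit for `E` (to pass to the Néron normalisation). This pins the research stub of the route's
descent crux to a classical one-variable statement and lists the published inputs its packaging needs. -/

/-- Kobayashi's `L_p^ε` picked out of a Pollack pair is non-zero (Pollack Cor. 5.11, carried by `IsPollackPair`).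
[cite: Pollack2003, Cor. 5.11] -/
theorem kobayashiL_ne_zero {N : ℕ} [NeZero N] {f : CuspForm (Gamma0 N) 2} {p : ℕ} [Fact p.Prime]
    {Lplus Lminus : IwasawaAlgebra p} (hPP : IsPollackPair f p Lplus Lminus) (ε : ℤˣ) :
    kobayashiL ε Lplus Lminus ≠ 0 := by
  unfold kobayashiL
  split_ifs
  · exact hPP.2.1
  · exact hPP.1

/-- Four-factor product squeeze (domain algebra): `gᵢ ∣ Lᵢ` (`i = 1..4`), `L₁L₂L₃L₄ ∣ g₁g₂g₃g₄`, all `Lᵢ ≠ 0`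
⇒ `g₁` and `L₁` are associated. [folklore] -/
theorem associated_of_dvd_of_mul4_dvd {R : Type*} [CommRing R] [IsDomain R] {g₁ g₂ g₃ g₄ L₁ L₂ L₃ L₄ : R}
    (h₁ : g₁ ∣ L₁) (h₂ : g₂ ∣ L₂) (h₃ : g₃ ∣ L₃) (h₄ : g₄ ∣ L₄)
    (hL₁ : L₁ ≠ 0) (hL₂ : L₂ ≠ 0) (hL₃ : L₃ ≠ 0) (hL₄ : L₄ ≠ 0)
    (hprod : L₁ * L₂ * L₃ * L₄ ∣ g₁ * g₂ * g₃ * g₄) : Associated g₁ L₁ := by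
  obtain ⟨k₁, hk₁⟩ := h₁
  obtain ⟨k₂, hk₂⟩ := h₂
  obtain ⟨k₃, hk₃⟩ := h₃
  obtain ⟨k₄, hk₄⟩ := h₄
  obtain ⟨m, hm⟩ := hprod
  have hg0 : g₁ * g₂ * g₃ * g₄ ≠ 0 := by
    refine mul_ne_zero (mul_ne_zero (mul_ne_zero ?_ ?_) ?_) ?_
    · rintro rfl; exact hL₁ (by rw [hk₁, zero_mul])
    · rintro rfl; exact hL₂ (by rw [hk₂, zero_mul])
    · rintro rfl; exact hL₃ (by rw [hk₃, zero_mul])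
    · rintro rfl; exact hL₄ (by rw [hk₄, zero_mul])
  have h1 : (k₁ * k₂ * k₃ * k₄) * m = 1 := by
    apply mul_left_cancel₀ hg0
    rw [mul_one, ← mul_assoc]
    calc g₁ * g₂ * g₃ * g₄ * (k₁ * k₂ * k₃ * k₄) * m
        = (g₁ * k₁) * (g₂ * k₂) * (g₃ * k₃) * (g₄ * k₄) * m := by ring
      _ = L₁ * L₂ * L₃ * L₄ * m := by rw [← hk₁, ← hk₂, ← hk₃, ← hk₄]
      _ = g₁ * g₂ * g₃ * g₄ := hm.symm
  have hunit : IsUnit (k₁ * k₂ * k₃ * k₄) := IsUnit.of_mul_eq_one m h1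
  have hk : IsUnit k₁ :=
    isUnit_of_dvd_unit ⟨k₂ * k₃ * k₄, by ring⟩ hunit
  exact ⟨hk.unit, by rw [IsUnit.unit_spec, hk₁]⟩

/-- **Packaging the descent's output.** Let `(W, p)` be an X7 pair with `p ≥ 5` and `ρ̄` onto, and `W₂, W₃, W₄`
three further globally minimal elliptic curves over `ℚ` with good reduction at `p`, `a_p = 0` and `ρ̄` onto (in the
route: the minimal models of `E^K`, `E^{(d)}`, `E^{(dK)}`). Granted BY NAME Kobayashi Thm. 1.2 (`h12`), Thm. 4.1
(`h41`), modularity (`hmod`, to have newforms of `W₂, W₃, W₄`) and the period unit (`h5`, for `W` only), the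
ϖ-free `f`-NORMALISED PRODUCT LOWER DIVISIBILITY `hPLD` — for the common cyclotomic data `(κ, γ)`, any newforms
`fᵢ`, Pollack pairs `(Lᵢ⁺, Lᵢ⁻)`, signed Selmer data `Dᵢ` with generators `gᵢ` of `Char X^ε(Eᵢ/ℚ_∞)`:
`L^ε(f₁)·L^ε(f₂)·L^ε(f₃)·L^ε(f₄) ∣ g₁·g₂·g₃·g₄` in `Λ` — implies `KobayashiMainConjecture W p ε`. Proof: Pollack
pairs (`pollack_exists_plusMinusPAdicLFunction_holds`), Selmer data (`nonempty_signedSelmerDualData`) and generators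
(`charIdeal_isPrincipal_holds`) exist for the auxiliary curves; Thm. 4.1 gives `gᵢ ∣ L^ε(fᵢ)` for all four
(integral under `Surj`); the four-factor squeeze gives `(g₁) = (L^ε(f₁))`; `h5` turns it into the Néron form.
[cite: Kobayashi2003, Conjecture (p. 2), Thm. 1.2, Thm. 4.1 (p. 8)] [cite: Pollack2003, Thm. 5.6 and Cor. 5.11]
[cite: GreenbergVatsal2000, §3 Remark 3.4] -/
theorem X7.kobayashiMainConjecture_of_productLowerDivisibility
    (h12 : thm12_signedSelmerDual_finite_torsion) (h41 : thm41_signedCharIdeal_divisibility)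
    (hmod : nonempty_modularParametrizationData) (h5 : realPeriodRat_eq_unit_mul_plusPeriod)
    (W : WeierstrassCurve ℚ) [W.IsElliptic] [W.IsGloballyMinimal] (p : ℕ) [Fact p.Prime]
    (hp5 : 5 ≤ p) (hX : ClassX7 W p) (hs : Surj W p)
    (W₂ W₃ W₄ : WeierstrassCurve ℚ) [W₂.IsElliptic] [W₂.IsGloballyMinimal] [W₃.IsElliptic] [W₃.IsGloballyMinimal]
    [W₄.IsElliptic] [W₄.IsGloballyMinimal]
    (hgood₂ : W₂.HasGoodReductionAtPrime p) (hap₂ : W₂.frobeniusTrace p = 0) (hs₂ : Surj W₂ p)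
    (hgood₃ : W₃.HasGoodReductionAtPrime p) (hap₃ : W₃.frobeniusTrace p = 0) (hs₃ : Surj W₃ p)
    (hgood₄ : W₄.HasGoodReductionAtPrime p) (hap₄ : W₄.frobeniusTrace p = 0) (hs₄ : Surj W₄ p)
    (ε : ℤˣ)
    (hPLD : ∀ (κ : ZpExtension ℚ p) (γ : Field.absoluteGaloisGroup ℚ),
      κ.IsCyclotomic → κ.IsTopGenerator γ → IsCyclotomicVariable p γ →
      ∀ {N₁ : ℕ} [NeZero N₁] (f₁ : CuspForm (Gamma0 N₁) 2), IsNewformOf W f₁ →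
      ∀ (Lp₁ Lm₁ : IwasawaAlgebra p), IsPollackPair f₁ p Lp₁ Lm₁ →
      ∀ (D₁ : SignedSelmerDualData W κ γ ε) (g₁ : IwasawaAlgebra p), D₁.charIdeal = Ideal.span {g₁} →
      ∀ {N₂ : ℕ} [NeZero N₂] (f₂ : CuspForm (Gamma0 N₂) 2), IsNewformOf W₂ f₂ →
      ∀ (Lp₂ Lm₂ : IwasawaAlgebra p), IsPollackPair f₂ p Lp₂ Lm₂ →
      ∀ (D₂ : SignedSelmerDualData W₂ κ γ ε) (g₂ : IwasawaAlgebra p), D₂.charIdeal = Ideal.span {g₂} →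
      ∀ {N₃ : ℕ} [NeZero N₃] (f₃ : CuspForm (Gamma0 N₃) 2), IsNewformOf W₃ f₃ →
      ∀ (Lp₃ Lm₃ : IwasawaAlgebra p), IsPollackPair f₃ p Lp₃ Lm₃ →
      ∀ (D₃ : SignedSelmerDualData W₃ κ γ ε) (g₃ : IwasawaAlgebra p), D₃.charIdeal = Ideal.span {g₃} →
      ∀ {N₄ : ℕ} [NeZero N₄] (f₄ : CuspForm (Gamma0 N₄) 2), IsNewformOf W₄ f₄ →
      ∀ (Lp₄ Lm₄ : IwasawaAlgebra p), IsPollackPair f₄ p Lp₄ Lm₄ →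
      ∀ (D₄ : SignedSelmerDualData W₄ κ γ ε) (g₄ : IwasawaAlgebra p), D₄.charIdeal = Ideal.span {g₄} →
      kobayashiL ε Lp₁ Lm₁ * kobayashiL ε Lp₂ Lm₂ * kobayashiL ε Lp₃ Lm₃ * kobayashiL ε Lp₄ Lm₄ ∣
        g₁ * g₂ * g₃ * g₄) :
    KobayashiMainConjecture W p ε := by
  have hp : p ≠ 2 := by omega
  have hgood : W.HasGoodReductionAtPrime p := hX.1.1
  have hap : W.frobeniusTrace p = 0 := ClassX7.frobeniusTrace_eq_zero_of_five_le W p hp5 hX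
  intro κ γ hκ hγ hγ' _ f hf ϖ hϖ Lp Lm hPP D
  -- Thm. 1.2 for `W`
  haveI hfin : Module.Finite (IwasawaAlgebra p) D.X := h12.moduleFinite hp hgood hap hκ hγ D
  have hXt : Module.IsTorsion (IwasawaAlgebra p) D.X := h12.isTorsion hp hgood hap hκ hγ D
  refine ⟨hXt, ?_⟩
  obtain ⟨g₁, hg₁⟩ := (charIdeal_isPrincipal_holds p D.X).principal
  have hg₁' : D.charIdeal = Ideal.span {g₁} := hg₁
  -- auxiliary data for `W₂, W₃, W₄`: newform (modularity), Pollack pair, Selmer datum, generator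
  haveI : NeZero (W₂.conductorNorm ℤ) := ⟨(W₂.conductorNorm_pos_holds).ne'⟩
  haveI : NeZero (W₃.conductorNorm ℤ) := ⟨(W₃.conductorNorm_pos_holds).ne'⟩
  haveI : NeZero (W₄.conductorNorm ℤ) := ⟨(W₄.conductorNorm_pos_holds).ne'⟩
  obtain ⟨Dm₂⟩ := hmod W₂
  obtain ⟨Dm₃⟩ := hmod W₃
  obtain ⟨Dm₄⟩ := hmod W₄
  obtain ⟨Lp₂, Lm₂, hPP₂⟩ :=
    exists_isPollackPair pollack_exists_plusMinusPAdicLFunction_holds hp Dm₂.isNewformOf hgood₂ hap₂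
  obtain ⟨Lp₃, Lm₃, hPP₃⟩ :=
    exists_isPollackPair pollack_exists_plusMinusPAdicLFunction_holds hp Dm₃.isNewformOf hgood₃ hap₃
  obtain ⟨Lp₄, Lm₄, hPP₄⟩ :=
    exists_isPollackPair pollack_exists_plusMinusPAdicLFunction_holds hp Dm₄.isNewformOf hgood₄ hap₄
  obtain ⟨D₂⟩ := nonempty_signedSelmerDualData W₂ κ ε hγ
  obtain ⟨D₃⟩ := nonempty_signedSelmerDualData W₃ κ ε hγ
  obtain ⟨D₄⟩ := nonempty_signedSelmerDualData W₄ κ ε hγ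
  obtain ⟨g₂, hg₂⟩ := (charIdeal_isPrincipal_holds p D₂.X).principal
  obtain ⟨g₃, hg₃⟩ := (charIdeal_isPrincipal_holds p D₃.X).principal
  obtain ⟨g₄, hg₄⟩ := (charIdeal_isPrincipal_holds p D₄.X).principal
  have hg₂' : D₂.charIdeal = Ideal.span {g₂} := hg₂
  have hg₃' : D₃.charIdeal = Ideal.span {g₃} := hg₃
  have hg₄' : D₄.charIdeal = Ideal.span {g₄} := hg₄
  -- the descent's output: the product lower divisibility
  have hprod := hPLD κ γ hκ hγ hγ' f hf Lp Lm hPP D g₁ hg₁' Dm₂.f Dm₂.isNewformOf Lp₂ Lm₂ hPP₂ D₂ g₂ hg₂'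
    Dm₃.f Dm₃.isNewformOf Lp₃ Lm₃ hPP₃ D₃ g₃ hg₃' Dm₄.f Dm₄.isNewformOf Lp₄ Lm₄ hPP₄ D₄ g₄ hg₄'
  -- Kobayashi Thm. 4.1 (integral under `Surj`) for each of the four curves
  have hL20 := Wuthrich2014.lemma20_surjective_threeAdic_of_semistable_holds
  have hK₁ : g₁ ∣ kobayashiL ε Lp Lm :=
    h41.dvd_of_charIdeal_eq_span hp hgood hap hf hκ hγ hγ' (hPP.isSignedPAdicLFunction_kobayashiL ε) D hXt
      (surjective_pow_of_surj_of_good W p hL20 hp hgood hs) hg₁'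
  haveI : Module.Finite (IwasawaAlgebra p) D₂.X := h12.moduleFinite hp hgood₂ hap₂ hκ hγ D₂
  haveI : Module.Finite (IwasawaAlgebra p) D₃.X := h12.moduleFinite hp hgood₃ hap₃ hκ hγ D₃
  haveI : Module.Finite (IwasawaAlgebra p) D₄.X := h12.moduleFinite hp hgood₄ hap₄ hκ hγ D₄
  have hK₂ : g₂ ∣ kobayashiL ε Lp₂ Lm₂ :=
    h41.dvd_of_charIdeal_eq_span hp hgood₂ hap₂ Dm₂.isNewformOf hκ hγ hγ'
      (hPP₂.isSignedPAdicLFunction_kobayashiL ε) D₂ (h12.isTorsion hp hgood₂ hap₂ hκ hγ D₂)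
      (surjective_pow_of_surj_of_good W₂ p hL20 hp hgood₂ hs₂) hg₂'
  have hK₃ : g₃ ∣ kobayashiL ε Lp₃ Lm₃ :=
    h41.dvd_of_charIdeal_eq_span hp hgood₃ hap₃ Dm₃.isNewformOf hκ hγ hγ'
      (hPP₃.isSignedPAdicLFunction_kobayashiL ε) D₃ (h12.isTorsion hp hgood₃ hap₃ hκ hγ D₃)
      (surjective_pow_of_surj_of_good W₃ p hL20 hp hgood₃ hs₃) hg₃'
  have hK₄ : g₄ ∣ kobayashiL ε Lp₄ Lm₄ :=
    h41.dvd_of_charIdeal_eq_span hp hgood₄ hap₄ Dm₄.isNewformOf hκ hγ hγ'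
      (hPP₄.isSignedPAdicLFunction_kobayashiL ε) D₄ (h12.isTorsion hp hgood₄ hap₄ hκ hγ D₄)
      (surjective_pow_of_surj_of_good W₄ p hL20 hp hgood₄ hs₄) hg₄'
  -- squeeze: `(g₁) = (L^ε(f))`
  have hassoc : Associated g₁ (kobayashiL ε Lp Lm) :=
    associated_of_dvd_of_mul4_dvd hK₁ hK₂ hK₃ hK₄ (kobayashiL_ne_zero hPP ε) (kobayashiL_ne_zero hPP₂ ε)
      (kobayashiL_ne_zero hPP₃ ε) (kobayashiL_ne_zero hPP₄ ε) hprod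
  have hchar : D.charIdeal = Ideal.span {kobayashiL ε Lp Lm} := by
    rw [hg₁']; exact Ideal.span_singleton_eq_span_singleton.mpr hassoc
  -- Néron normalisation: `ϖ` is a `p`-adic unit
  set L := kobayashiL ε Lp Lm with hL_def
  have hvϖ : padicValRat p ϖ = 0 :=
    padicValRat_periodRatio_eq_zero_of_five_le h5 W p hp5 hgood (ClassX7.irr W p hp hX) f hf ϖ hϖ
  have hϖ0 : ϖ ≠ 0 := by
    intro hz
    rw [hz, Rat.cast_zero, zero_mul] at hϖ
    exact (IsNewform0.plusPeriod_pos_holds hf.1 hf.coeffField_eq_bot).ne' hϖ.symm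
  obtain ⟨u, hu⟩ := exists_units_coe_eq_ratCast hϖ0 hvϖ
  obtain ⟨hspan', hι⟩ := span_C_units_mul_eq u L
  refine ⟨PowerSeries.C (u : ℤ_[p]) * L, ?_, ?_⟩
  · rw [hchar, hspan']
  · rw [hι, hu]

end Summit.BirchSwinnertonDyer.BirchSwinnertonDyer.Theorems.SignedBaseChangeEisensteinSqueeze

end
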